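import Literature.AlgebraicGeometry.HodgeTheory.VHSDataSubHodgeStructureTranslateLocusCharted
import Literature.AlgebraicGeometry.HodgeTheory.VHSDataSimultaneousDeterminationLocusDescent
import Literature.AlgebraicGeometry.HodgeTheory.VHSDataComapCharts
import HarnessLib

/-!
# Cattani–Deligne–Kaplan's Corollary 1.4 seen from a covering space: the locus where some flat translate of `U ⊆ V_{f(s′₀)}` is a sub-Hodge
# structure is the IMAGE of the same locus for `f^*𝒱`; «everything or finite» descends along a surjective covering; chart-fed forms on `S` from
# flat charts UPSTAIRS (a line: charts of `f^*D`; `dim U = d`: charts of `⋀ᵈ f^*D = f^*⋀ᵈ D`), for one subspace and for finite collections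

Topic `Literature/AlgebraicGeometry/HodgeTheory` (namespaces `Literature.AlgebraicGeometry.HodgeTheory` for the base-point-free path-lifting lemma of §1,
`Literature.AlgebraicGeometry.Motives.VHSData[.IsLocallyFlatCharted]` for the rest), lane `lit-hodgefound` (seat `p08`, row g60-#5).  THEOREMS ONLY — no
definition, no named fact, no instance, no notation (D-0026 net debt `0`).  Sequel of `Motives/FamiliesVHSComapCovering` and
`HodgeTheory/VHSDataSimultaneousDeterminationLocusDescent` (descent of the Cor-1.3 determination loci along coverings, single and simultaneous), of
`HodgeTheory/VHSDataSubHodgeStructureTranslateLocus[ExteriorPower∕Charted]` (the Cor-1.4 locus of a line `ℚ·u₀` is the determination locus of `u₀`, of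
a `d`-dimensional `U` that of an integral frame `m₁ ∧ ⋯ ∧ m_d` in `⋀ᵈ D`; everything-or-finite from bundled flat charts) and of
`HodgeTheory/VHSDataComapCharts` (interior charts pull back to the sheets of a covering).

PRINTED SOURCE, VERBATIM.  E. Cattani, P. Deligne, A. Kaplan, *On the locus of Hodge classes*, J. AMS 8 (1995) 483–506 (held text
`paper:arxiv-alg-geom_9402009` p0001–p0002).  P. 486: «**Corollary 1.4.** Let `𝒱` be a polarizable variation of Hodge structures on `S`, fix `s ∈ S`
and let `U_ℚ ⊂ (𝒱_s)_ℚ` be a rational subspace. The locus where some flat translate of `U_ℚ` is a Hodge substructure is an algebraic subvariety of `S`.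
*Proof*: … suppose first that `U_ℚ` is of dimension one. … `U_ℚ` is a Hodge substructure if and only if `e` is of type `(0,0)`, and one applies 1.3.
Consider now the general case: `U` of dimension `n`. … This amounts to … `⋀ⁿ U_ℚ` being a Hodge substructure of `⋀ⁿ H_ℚ`, and reduces us to the
one-dimensional case.»  P. 485, «Proof of 1.5 ⟹ 1.1»: «To prove 1.1 one is free to replace `S` by a finite etale covering `S′ → S` … we may and shall
assume that `S̄ − S` consists of points around which the local monodromy is unipotent.»  P. Deligne, *Équations différentielles à points singuliers
réguliers*, LNM 163 (1970), I.1: `(f^*𝒱)_{s′} = 𝒱_{f(s′)}`, transport of `f^*𝒱` along `γ′` = transport of `𝒱` along `f ∘ γ′`; `⋀ⁿ` commutes with `f^*`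
(both hold ON THE NOSE for the tree's `VHSData.comap` ∕ `VHSData.exteriorPower`: `comap_exteriorPower` below is `rfl`).  B. Moonen, F. Oort, *The Torelli
locus and special subvarieties* (arXiv:1112.0933 p. 9, §3 Def. 4 ∕ Rem. 5): finite collections, «the image of this locus in `S`».

THE DICTIONARY (as in the sibling files).  «Some flat translate of `U` at `t` is a Hodge substructure» from the base point `s` is
`∃ γ : Path.Homotopic.Quotient s t, ∃ W : SubHodgeStructure (D.hodge t), W.toSubmodule = U.map (D.V.transport γ)`; for the pull-back `f^*D = D.comap f`
along `f : S′ → S` the fibre at `s′` IS `V_{f(s′)}` and `(D.comap f).V.transport γ′ = D.V.transport (γ′.map f)` (`rfl`).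

CONTENT.
* §1 **PATH-CLASS LOCI SEEN FROM A COVERING SPACE** (`image_setOf_exists_pathClass_map_eq`): for a covering map `f`, a base point `s′₀` and ANY
  property `Q t γ` of path classes `γ : f(s′₀) ⇝ t` downstairs, `f {t′ | ∃ γ′ : s′₀ ⇝ t′, Q (f t′) (f ∘ γ′)} = {t | ∃ γ, Q t γ}` — `⊆` trivially, `⊇` by
  Mathlib's path lifting (`IsCoveringMap.liftPathQuotient`, `map_liftPathQuotient`, `monodromy`); hence «everything or finite», «finite», «everything»
  DESCEND along a surjective covering for every such locus (the common core of the tree's descents for determination loci, made base-property-free).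
* §2 **COR. 1.4 FROM A COVERING, ONE SUBSPACE**: `image_translateLocus_comap` (the Cor-1.4 locus of `U ⊆ V_{f(s′₀)}` for `D` is `f` of the Cor-1.4
  locus of `U ⊆ (f^*V)_{s′₀} = V_{f(s′₀)}` for `f^*D`), `translateLocus_comap_subset_preimage`, `mem_translateLocus_iff_exists_fiber`, and the descents
  **`translateLocus_eq_univ_or_finite_of_comap_covering`**, `translateLocus_finite_of_comap_covering`, `translateLocus_eq_univ_of_comap_covering`.
* §3 **FINITE COLLECTIONS** `U_m ⊆ (V_m)_{f(s′₀)}` in finitely many variations `D_m` (dependent family), ONE path class for all: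
  `image_setOf_exists_forall_subHodgeStructure_translate_comap` and the three descents.
* §4 **CHART-FED FORMS ON `S` FROM FLAT CHARTS UPSTAIRS** («replace `S` by a finite etale covering» for Cor. 1.4): a LINE `ℚ·u₀` from flat charts of
  `f^*D` (`IsLocallyFlatCharted.translateLocus_line_eq_univ_or_finite_of_comap_covering`; `…_of_compactification` with the ends of `S′` read off a
  compactification of `S′`; **`translateLocus_line_eq_univ_or_finite_of_sheets`**: flat interior charts of `D` DOWNSTAIRS and flat puncture charts of
  `f^*D` UPSTAIRS only); `dim U = d` from flat charts of `⋀ᵈ(f^*D)` (**`translateLocus_eq_univ_or_finite_of_isLocallyFlatCharted_exteriorPower_comap_covering`**,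
  `comap_exteriorPower : f^*(⋀ᵈ D) = ⋀ᵈ(f^*D)` definitionally); finite collections of lines ∕ of subspaces through a covering
  (`setOf_exists_forall_subHodgeStructure_translate_line_eq_univ_or_finite_of_comap_covering`, `setOf_exists_forall_subHodgeStructure_translate_eq_univ_or_finite_of_comap_covering`).

HONEST SCOPE.  `dim S = 1` for §4; flat charts are HYPOTHESES (of `f^*D`, resp. of the `⋀ᵈ f^*D`), exactly as in the sibling chart files; §1–§3 are
chart-free and hold for any covering map of topological spaces.  Not here: the construction of the finite étale cover with unipotent local monodromy
(the tree's `VHSDataUnipotentMonodromyFiniteEtaleCover`), several-dimensional bases, the Zariski-closed (`IsZariskiClosedOnPoints`) junction forms.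

## References

* [CattaniDeligneKaplan1995] E. Cattani, P. Deligne, A. Kaplan, *On the locus of Hodge classes*, J. Amer. Math. Soc. 8 (1995) 483–506: Cor. 1.3 (p. 484),
  Cor. 1.4 and its proof (p. 486), «Proof of 1.5 ⟹ 1.1» (p. 485), 2.3 (p. 487).
* [Deligne1970] P. Deligne, *Équations différentielles à points singuliers réguliers*, LNM 163 (1970), I.1.
* [MoonenOort2013Torelli] B. Moonen, F. Oort, *The Torelli locus and special subvarieties*, Handbook of Moduli II (2013), §3 Def. 4, Rem. 5 (arXiv p. 9).
* [FritzscheGrauert2002] K. Fritzsche, H. Grauert, *From Holomorphic Functions to Complex Manifolds*, GTM 213 (2002), Ch. IV §1 (charts on the sheets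
  of an unbranched covering; cite only, through `VHSDataComapCharts`).
-/

noncomputable section

open scoped TensorProduct
open _root_.Topology _root_.Filter Set

universe u

namespace Literature.AlgebraicGeometry

open Motives Motives.HodgeStructure HodgeTheory Topology

/-! ## §1 Path-class loci seen from a covering space -/

namespace HodgeTheory

variable {S : Type*} [TopologicalSpace S] {S' : Type*} [TopologicalSpace S'] {f : C(S', S)}

/-- Pushing forward needs no covering hypothesis: a witness `γ′ : s′₀ ⇝ t′` upstairs gives the witness `f ∘ γ′ : f(s′₀) ⇝ f(t′)` downstairs.
[cite: Deligne1970, I.1] -/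
theorem setOf_exists_pathClass_map_subset_preimage (s'₀ : S') (Q : ∀ t : S, Path.Homotopic.Quotient (f s'₀) t → Prop) :
    {t' : S' | ∃ γ' : Path.Homotopic.Quotient s'₀ t', Q (f t') (γ'.map f)} ⊆ f ⁻¹' {t : S | ∃ γ : Path.Homotopic.Quotient (f s'₀) t, Q t γ} :=
  fun _ ⟨γ', hγ'⟩ => ⟨γ'.map f, hγ'⟩

/-- **PATH-CLASS LOCI SEEN FROM A COVERING SPACE.**  For a covering map `f : S′ → S`, a base point `s′₀` and any property `Q t γ` of path classes
`γ : f(s′₀) ⇝ t`, **`f {t′ | ∃ γ′ : s′₀ ⇝ t′, Q (f t′) (f ∘ γ′)} = {t | ∃ γ : f(s′₀) ⇝ t, Q t γ}`**: every `γ` lifts to a `γ̃ : s′₀ ⇝ t′` with `f ∘ γ̃ = γ`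
(Mathlib's `IsCoveringMap.liftPathQuotient`, `map_liftPathQuotient`), `f t′ = t` (`monodromy`). This is the common core of «the set of points in `S`
where some determination of `u` is …» read on a covering («a section of the local system on a universal covering of `S`»).
[cite: CattaniDeligneKaplan1995, Cor. 1.3 (p. 484) and «Proof of 1.5 ⟹ 1.1» (p. 485)] [cite: Deligne1970, I.1] -/
theorem image_setOf_exists_pathClass_map_eq (hf : IsCoveringMap f) (s'₀ : S') (Q : ∀ t : S, Path.Homotopic.Quotient (f s'₀) t → Prop) :
    f '' {t' : S' | ∃ γ' : Path.Homotopic.Quotient s'₀ t', Q (f t') (γ'.map f)} = {t : S | ∃ γ : Path.Homotopic.Quotient (f s'₀) t, Q t γ} := by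
  refine Subset.antisymm (image_subset_iff.2 (setOf_exists_pathClass_map_subset_preimage s'₀ Q)) ?_
  rintro t ⟨γ, hγ⟩
  -- every lift of `γ` ending at a point `x` of the fibre over `t` is a witness upstairs at `x`
  have key : ∀ (x : f ⁻¹' {t}) (γ' : Path.Homotopic.Quotient s'₀ x.1), γ'.map f = γ.cast rfl x.2 → Q (f x.1) (γ'.map f) := by
    rintro ⟨t', ht'⟩ γ' hγ'
    change f t' = t at ht'
    subst ht'
    rw [hγ', Path.Homotopic.Quotient.cast_rfl_rfl]
    exact hγ
  exact ⟨_, ⟨hf.liftPathQuotient γ ⟨s'₀, rfl⟩, key _ (hf.liftPathQuotient γ ⟨s'₀, rfl⟩) (hf.map_liftPathQuotient γ ⟨s'₀, rfl⟩)⟩,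
    (hf.monodromy γ ⟨s'₀, rfl⟩).2⟩

/-- Membership form: `t` is in the locus downstairs iff SOME point `t′` of the fibre `f⁻¹(t)` is in the locus upstairs.
[cite: CattaniDeligneKaplan1995, Cor. 1.3 (p. 484)] [cite: Deligne1970, I.1] -/
theorem mem_setOf_exists_pathClass_iff_exists_fiber (hf : IsCoveringMap f) (s'₀ : S') (Q : ∀ t : S, Path.Homotopic.Quotient (f s'₀) t → Prop)
    (t : S) : (∃ γ : Path.Homotopic.Quotient (f s'₀) t, Q t γ) ↔ ∃ t' : S', f t' = t ∧ ∃ γ' : Path.Homotopic.Quotient s'₀ t', Q (f t') (γ'.map f) := by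
  have h := Set.ext_iff.1 (image_setOf_exists_pathClass_map_eq hf s'₀ Q) t
  simp only [mem_image, mem_setOf_eq] at h
  rw [← h]
  exact ⟨fun ⟨t', h', ht'⟩ => ⟨t', ht', h'⟩, fun ⟨t', ht', h'⟩ => ⟨t', h', ht'⟩⟩

/-- **DESCENT OF «EVERYTHING OR FINITE» ALONG A SURJECTIVE COVERING MAP**, for any path-class locus («one is free to replace `S` by a finite etale
covering `S′ → S`»). [cite: CattaniDeligneKaplan1995, «Proof of 1.5 ⟹ 1.1» (p. 485)] -/
theorem setOf_exists_pathClass_eq_univ_or_finite_of_covering (hf : IsCoveringMap f) (hsurj : Function.Surjective f) (s'₀ : S')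
    (Q : ∀ t : S, Path.Homotopic.Quotient (f s'₀) t → Prop)
    (h : {t' : S' | ∃ γ' : Path.Homotopic.Quotient s'₀ t', Q (f t') (γ'.map f)} = univ ∨
      {t' : S' | ∃ γ' : Path.Homotopic.Quotient s'₀ t', Q (f t') (γ'.map f)}.Finite) :
    {t : S | ∃ γ : Path.Homotopic.Quotient (f s'₀) t, Q t γ} = univ ∨ {t : S | ∃ γ : Path.Homotopic.Quotient (f s'₀) t, Q t γ}.Finite := by
  rw [← image_setOf_exists_pathClass_map_eq hf s'₀ Q]
  rcases h with huniv | hfin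
  · exact Or.inl (by rw [huniv, image_univ, hsurj.range_eq])
  · exact Or.inr (hfin.image f)

/-- The finite half needs no surjectivity. [cite: CattaniDeligneKaplan1995, «Proof of 1.5 ⟹ 1.1» (p. 485)] -/
theorem setOf_exists_pathClass_finite_of_covering (hf : IsCoveringMap f) (s'₀ : S') (Q : ∀ t : S, Path.Homotopic.Quotient (f s'₀) t → Prop)
    (h : {t' : S' | ∃ γ' : Path.Homotopic.Quotient s'₀ t', Q (f t') (γ'.map f)}.Finite) :
    {t : S | ∃ γ : Path.Homotopic.Quotient (f s'₀) t, Q t γ}.Finite := by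
  rw [← image_setOf_exists_pathClass_map_eq hf s'₀ Q]
  exact h.image f

/-- «Everything upstairs» gives «everything downstairs» for `f` surjective. [cite: CattaniDeligneKaplan1995, «Proof of 1.5 ⟹ 1.1» (p. 485)] -/
theorem setOf_exists_pathClass_eq_univ_of_covering (hf : IsCoveringMap f) (hsurj : Function.Surjective f) (s'₀ : S')
    (Q : ∀ t : S, Path.Homotopic.Quotient (f s'₀) t → Prop)
    (h : {t' : S' | ∃ γ' : Path.Homotopic.Quotient s'₀ t', Q (f t') (γ'.map f)} = univ) :
    {t : S | ∃ γ : Path.Homotopic.Quotient (f s'₀) t, Q t γ} = univ := by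
  rw [← image_setOf_exists_pathClass_map_eq hf s'₀ Q, h, image_univ, hsurj.range_eq]

end HodgeTheory

namespace Motives.VHSData

variable {S : Type} [TopologicalSpace S] {S' : Type} [TopologicalSpace S'] {k : ℤ} (D : VHSData S k) (f : C(S', S))

/-! ## §2 Corollary 1.4 seen from a covering space: one rational subspace -/

/-- **`f^*(⋀ᵈ D) = ⋀ᵈ(f^*D)` ON THE NOSE** (`⋀ᵈ` of a local system is post-composition with the functor `⋀ᵈ`, pull-back is pre-composition with `Π₁(f)`).
[cite: Deligne1970, I.1] -/
theorem comap_exteriorPower (d : ℕ) : (D.exteriorPower d).comap f = (D.comap f).exteriorPower d := rfl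

/-- Pushing forward: a flat translate of `U` along `γ′` upstairs that is a sub-Hodge structure of `(f^*V)_{t′} = V_{f(t′)}` is the flat translate along
`f ∘ γ′` downstairs. [cite: CattaniDeligneKaplan1995, Cor. 1.4 (p. 486)] [cite: Deligne1970, I.1] -/
theorem translateLocus_comap_subset_preimage (s'₀ : S') (U : Submodule ℚ (D.V.fiber (f s'₀))) :
    {t' : S' | ∃ γ' : Path.Homotopic.Quotient s'₀ t', ∃ W : SubHodgeStructure ((D.comap f).hodge t'),
        W.toSubmodule = U.map ((D.comap f).V.transport γ')} ⊆
      f ⁻¹' {t : S | ∃ γ : Path.Homotopic.Quotient (f s'₀) t, ∃ W : SubHodgeStructure (D.hodge t), W.toSubmodule = U.map (D.V.transport γ)} :=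
  setOf_exists_pathClass_map_subset_preimage s'₀ fun t γ => ∃ W : SubHodgeStructure (D.hodge t), W.toSubmodule = U.map (D.V.transport γ)

/-- **COR. 1.4 SEEN FROM A COVERING SPACE**: for a covering map `f : S′ → S`, `s′₀ ∈ S′` and a rational subspace `U ⊆ V_{f(s′₀)} = (f^*V)_{s′₀}`, **`f` of
the locus of `t′ ∈ S′` where some flat translate of `U` is a sub-Hodge structure of `(f^*V)_{t′}` IS the locus of `t ∈ S` where some flat translate of
`U` is a sub-Hodge structure of `V_t`** (path lifting). [cite: CattaniDeligneKaplan1995, Cor. 1.4 (p. 486), «Proof of 1.5 ⟹ 1.1» (p. 485)]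
[cite: Deligne1970, I.1] -/
theorem image_translateLocus_comap (hf : IsCoveringMap f) (s'₀ : S') (U : Submodule ℚ (D.V.fiber (f s'₀))) :
    f '' {t' : S' | ∃ γ' : Path.Homotopic.Quotient s'₀ t', ∃ W : SubHodgeStructure ((D.comap f).hodge t'),
        W.toSubmodule = U.map ((D.comap f).V.transport γ')} =
      {t : S | ∃ γ : Path.Homotopic.Quotient (f s'₀) t, ∃ W : SubHodgeStructure (D.hodge t), W.toSubmodule = U.map (D.V.transport γ)} :=
  image_setOf_exists_pathClass_map_eq hf s'₀ fun t γ => ∃ W : SubHodgeStructure (D.hodge t), W.toSubmodule = U.map (D.V.transport γ)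

/-- Membership form: some flat translate of `U` at `t` is a sub-Hodge structure iff this holds, for `f^*D`, at SOME point of the fibre `f⁻¹(t)`.
[cite: CattaniDeligneKaplan1995, Cor. 1.4 (p. 486)] [cite: Deligne1970, I.1] -/
theorem mem_translateLocus_iff_exists_fiber (hf : IsCoveringMap f) (s'₀ : S') (U : Submodule ℚ (D.V.fiber (f s'₀))) (t : S) :
    (∃ γ : Path.Homotopic.Quotient (f s'₀) t, ∃ W : SubHodgeStructure (D.hodge t), W.toSubmodule = U.map (D.V.transport γ)) ↔
      ∃ t' : S', f t' = t ∧ ∃ γ' : Path.Homotopic.Quotient s'₀ t', ∃ W : SubHodgeStructure ((D.comap f).hodge t'),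
        W.toSubmodule = U.map ((D.comap f).V.transport γ') :=
  mem_setOf_exists_pathClass_iff_exists_fiber hf s'₀
    (fun t γ => ∃ W : SubHodgeStructure (D.hodge t), W.toSubmodule = U.map (D.V.transport γ)) t

/-- **DESCENT FOR COR. 1.4** («one is free to replace `S` by a finite etale covering `S′ → S`»): for a SURJECTIVE covering map `f`, if the Cor-1.4
locus of `U` for `f^*D` from `s′₀` is all of `S′` or finite, then the Cor-1.4 locus of `U` for `D` from `f(s′₀)` is all of `S` or finite.
[cite: CattaniDeligneKaplan1995, Cor. 1.4 (p. 486) and «Proof of 1.5 ⟹ 1.1» (p. 485)] -/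
theorem translateLocus_eq_univ_or_finite_of_comap_covering (hf : IsCoveringMap f) (hsurj : Function.Surjective f) (s'₀ : S')
    (U : Submodule ℚ (D.V.fiber (f s'₀)))
    (h : {t' : S' | ∃ γ' : Path.Homotopic.Quotient s'₀ t', ∃ W : SubHodgeStructure ((D.comap f).hodge t'),
          W.toSubmodule = U.map ((D.comap f).V.transport γ')} = univ ∨
      {t' : S' | ∃ γ' : Path.Homotopic.Quotient s'₀ t', ∃ W : SubHodgeStructure ((D.comap f).hodge t'),
          W.toSubmodule = U.map ((D.comap f).V.transport γ')}.Finite) :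
    {t : S | ∃ γ : Path.Homotopic.Quotient (f s'₀) t, ∃ W : SubHodgeStructure (D.hodge t), W.toSubmodule = U.map (D.V.transport γ)} = univ ∨
      {t : S | ∃ γ : Path.Homotopic.Quotient (f s'₀) t, ∃ W : SubHodgeStructure (D.hodge t),
        W.toSubmodule = U.map (D.V.transport γ)}.Finite :=
  setOf_exists_pathClass_eq_univ_or_finite_of_covering hf hsurj s'₀
    (fun t γ => ∃ W : SubHodgeStructure (D.hodge t), W.toSubmodule = U.map (D.V.transport γ)) h

/-- The finite half needs no surjectivity. [cite: CattaniDeligneKaplan1995, Cor. 1.4 (p. 486)] -/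
theorem translateLocus_finite_of_comap_covering (hf : IsCoveringMap f) (s'₀ : S') (U : Submodule ℚ (D.V.fiber (f s'₀)))
    (h : {t' : S' | ∃ γ' : Path.Homotopic.Quotient s'₀ t', ∃ W : SubHodgeStructure ((D.comap f).hodge t'),
        W.toSubmodule = U.map ((D.comap f).V.transport γ')}.Finite) :
    {t : S | ∃ γ : Path.Homotopic.Quotient (f s'₀) t, ∃ W : SubHodgeStructure (D.hodge t), W.toSubmodule = U.map (D.V.transport γ)}.Finite :=
  setOf_exists_pathClass_finite_of_covering hf s'₀ (fun t γ => ∃ W : SubHodgeStructure (D.hodge t), W.toSubmodule = U.map (D.V.transport γ)) h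

/-- «Everything upstairs» gives «everything downstairs» for `f` surjective. [cite: CattaniDeligneKaplan1995, Cor. 1.4 (p. 486)] -/
theorem translateLocus_eq_univ_of_comap_covering (hf : IsCoveringMap f) (hsurj : Function.Surjective f) (s'₀ : S')
    (U : Submodule ℚ (D.V.fiber (f s'₀)))
    (h : {t' : S' | ∃ γ' : Path.Homotopic.Quotient s'₀ t', ∃ W : SubHodgeStructure ((D.comap f).hodge t'),
        W.toSubmodule = U.map ((D.comap f).V.transport γ')} = univ) :
    {t : S | ∃ γ : Path.Homotopic.Quotient (f s'₀) t, ∃ W : SubHodgeStructure (D.hodge t), W.toSubmodule = U.map (D.V.transport γ)} = univ :=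
  setOf_exists_pathClass_eq_univ_of_covering hf hsurj s'₀ (fun t γ => ∃ W : SubHodgeStructure (D.hodge t), W.toSubmodule = U.map (D.V.transport γ)) h

/-! ## §3 Finite collections of subspaces in finitely many variations, one path class for all -/

section Family

variable {ι' : Type*} {κ : ι' → ℤ} (E : (m : ι') → VHSData S (κ m))

/-- **FINITE COLLECTIONS SEEN FROM A COVERING SPACE**: for subspaces `U_m ⊆ (V_m)_{f(s′₀)}` of the fibres of variations `D_m`, **`f` of the locus of
`t′ ∈ S′` for which ONE path class `γ′ : s′₀ ⇝ t′` carries every `U_m` to a sub-Hodge structure of `(f^*V_m)_{t′}` IS the corresponding locus in `S`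
from `f(s′₀)`** («the image of this locus in `S`»). [cite: CattaniDeligneKaplan1995, Cor. 1.4 (p. 486)] [cite: MoonenOort2013Torelli, §3 Def. 4 (arXiv p. 9)]
[cite: Deligne1970, I.1] -/
theorem image_setOf_exists_forall_subHodgeStructure_translate_comap (hf : IsCoveringMap f) (s'₀ : S')
    (U : (m : ι') → Submodule ℚ ((E m).V.fiber (f s'₀))) :
    f '' {t' : S' | ∃ γ' : Path.Homotopic.Quotient s'₀ t', ∀ m, ∃ W : SubHodgeStructure (((E m).comap f).hodge t'),
        W.toSubmodule = (U m).map (((E m).comap f).V.transport γ')} =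
      {t : S | ∃ γ : Path.Homotopic.Quotient (f s'₀) t, ∀ m, ∃ W : SubHodgeStructure ((E m).hodge t),
        W.toSubmodule = (U m).map ((E m).V.transport γ)} :=
  image_setOf_exists_pathClass_map_eq hf s'₀ fun t γ =>
    ∀ m, ∃ W : SubHodgeStructure ((E m).hodge t), W.toSubmodule = (U m).map ((E m).V.transport γ)

/-- **DESCENT FOR FINITE COLLECTIONS**: «everything or finite» upstairs gives «everything or finite» downstairs for `f` a surjective covering map.
[cite: CattaniDeligneKaplan1995, Cor. 1.4 (p. 486), «Proof of 1.5 ⟹ 1.1» (p. 485)] [cite: MoonenOort2013Torelli, §3 Def. 4 (arXiv p. 9)] -/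
theorem setOf_exists_forall_subHodgeStructure_translate_eq_univ_or_finite_of_comap_covering (hf : IsCoveringMap f)
    (hsurj : Function.Surjective f) (s'₀ : S') (U : (m : ι') → Submodule ℚ ((E m).V.fiber (f s'₀)))
    (h : {t' : S' | ∃ γ' : Path.Homotopic.Quotient s'₀ t', ∀ m, ∃ W : SubHodgeStructure (((E m).comap f).hodge t'),
          W.toSubmodule = (U m).map (((E m).comap f).V.transport γ')} = univ ∨
      {t' : S' | ∃ γ' : Path.Homotopic.Quotient s'₀ t', ∀ m, ∃ W : SubHodgeStructure (((E m).comap f).hodge t'),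
          W.toSubmodule = (U m).map (((E m).comap f).V.transport γ')}.Finite) :
    {t : S | ∃ γ : Path.Homotopic.Quotient (f s'₀) t, ∀ m, ∃ W : SubHodgeStructure ((E m).hodge t),
        W.toSubmodule = (U m).map ((E m).V.transport γ)} = univ ∨
      {t : S | ∃ γ : Path.Homotopic.Quotient (f s'₀) t, ∀ m, ∃ W : SubHodgeStructure ((E m).hodge t),
        W.toSubmodule = (U m).map ((E m).V.transport γ)}.Finite :=
  setOf_exists_pathClass_eq_univ_or_finite_of_covering hf hsurj s'₀
    (fun t γ => ∀ m, ∃ W : SubHodgeStructure ((E m).hodge t), W.toSubmodule = (U m).map ((E m).V.transport γ)) h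

/-- The finite half needs no surjectivity. [cite: CattaniDeligneKaplan1995, Cor. 1.4 (p. 486)] [cite: MoonenOort2013Torelli, §3 Def. 4 (arXiv p. 9)] -/
theorem setOf_exists_forall_subHodgeStructure_translate_finite_of_comap_covering (hf : IsCoveringMap f) (s'₀ : S')
    (U : (m : ι') → Submodule ℚ ((E m).V.fiber (f s'₀)))
    (h : {t' : S' | ∃ γ' : Path.Homotopic.Quotient s'₀ t', ∀ m, ∃ W : SubHodgeStructure (((E m).comap f).hodge t'),
        W.toSubmodule = (U m).map (((E m).comap f).V.transport γ')}.Finite) :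
    {t : S | ∃ γ : Path.Homotopic.Quotient (f s'₀) t, ∀ m, ∃ W : SubHodgeStructure ((E m).hodge t),
        W.toSubmodule = (U m).map ((E m).V.transport γ)}.Finite :=
  setOf_exists_pathClass_finite_of_covering hf s'₀
    (fun t γ => ∀ m, ∃ W : SubHodgeStructure ((E m).hodge t), W.toSubmodule = (U m).map ((E m).V.transport γ)) h

/-- «Everything upstairs» gives «everything downstairs» for `f` surjective. [cite: CattaniDeligneKaplan1995, Cor. 1.4 (p. 486)]
[cite: MoonenOort2013Torelli, §3 Def. 4 (arXiv p. 9)] -/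
theorem setOf_exists_forall_subHodgeStructure_translate_eq_univ_of_comap_covering (hf : IsCoveringMap f) (hsurj : Function.Surjective f)
    (s'₀ : S') (U : (m : ι') → Submodule ℚ ((E m).V.fiber (f s'₀)))
    (h : {t' : S' | ∃ γ' : Path.Homotopic.Quotient s'₀ t', ∀ m, ∃ W : SubHodgeStructure (((E m).comap f).hodge t'),
        W.toSubmodule = (U m).map (((E m).comap f).V.transport γ')} = univ) :
    {t : S | ∃ γ : Path.Homotopic.Quotient (f s'₀) t, ∀ m, ∃ W : SubHodgeStructure ((E m).hodge t),
        W.toSubmodule = (U m).map ((E m).V.transport γ)} = univ :=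
  setOf_exists_pathClass_eq_univ_of_covering hf hsurj s'₀
    (fun t γ => ∀ m, ∃ W : SubHodgeStructure ((E m).hodge t), W.toSubmodule = (U m).map ((E m).V.transport γ)) h

end Family

/-! ## §4 Corollary 1.4 on `S` from flat charts on a covering `S′ → S` -/

variable {D} [PreconnectedSpace S']
variable {α' ι₁ : Type*} {ψ' : α' → OpenPartialHomeomorph S' ℂ} {σ' : ι₁ → ℂ → S'}
variable {X' : Type*} [TopologicalSpace X'] [CompactSpace X']

namespace IsLocallyFlatCharted

/-- **COR. 1.4 FOR A RATIONAL LINE `ℚ·u₀ ⊆ V_{f(s′₀)}` ON `S`, FROM FLAT CHARTS OF `f^*D` ON A COVERING `S′ → S`** («replace `S` by a finite etale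
covering», then «`U_ℚ` is a Hodge substructure if and only if `e` is of type `(0,0)`, and one applies 1.3»): `f` a SURJECTIVE COVERING MAP with `S′`
preconnected, `f^*D` locally flat-charted by discs `ψ′ a` covering `S′` and ends `σ′ i` (open ends, compact core, continuous ends upstairs), `u₀ ≠ 0`
integral, `p + p = k`; then **the set of `t ∈ S` such that SOME flat translate `γ · (ℚ·u₀) ⊆ V_t` underlies a sub-Hodge structure is ALL of `S` or
FINITE.** [cite: CattaniDeligneKaplan1995, Cor. 1.4 and its proof (p. 486), Cor. 1.3 (p. 484), «Proof of 1.5 ⟹ 1.1» (p. 485)] -/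
theorem translateLocus_line_eq_univ_or_finite_of_comap_covering (hf : IsCoveringMap f) (hsurj : Function.Surjective f)
    (h : (D.comap f).IsLocallyFlatCharted ψ' σ') {p : ℤ} (hpk : p + p = k) {s'₀ : S'} {u₀ : D.VZ.fiber (f s'₀)} (hu₀ : u₀ ≠ 0)
    (hcov : ∀ x' : S', ∃ a, x' ∈ (ψ' a).source) (A : ι₁ → ℝ) (hopen : ∀ (i : ι₁) (A' : ℝ), A i ≤ A' → IsOpen (σ' i '' {z : ℂ | A' < z.im}))
    (hcore : ∀ A' : ι₁ → ℝ, (∀ i, A i ≤ A' i) → ∃ K₀ : Set S', IsCompact K₀ ∧ K₀ ∪ ⋃ i, σ' i '' {z : ℂ | A' i < z.im} = univ)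
    (hcont : ∀ i, ContinuousOn (σ' i) {z : ℂ | A i < z.im}) :
    {t : S | ∃ γ : Path.Homotopic.Quotient (f s'₀) t, ∃ W : SubHodgeStructure (D.hodge t),
        W.toSubmodule = (ℚ ∙ D.toRat (f s'₀) u₀).map (D.V.transport γ)} = univ ∨
      {t : S | ∃ γ : Path.Homotopic.Quotient (f s'₀) t, ∃ W : SubHodgeStructure (D.hodge t),
        W.toSubmodule = (ℚ ∙ D.toRat (f s'₀) u₀).map (D.V.transport γ)}.Finite := by
  haveI : ∀ s : S, Module.Finite ℚ (D.V.fiber s) := fun s => D.finite_fiber s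
  rw [D.translateLocus_line_eq_determinationLocus (f s'₀) hu₀ hpk]
  exact VHSData.IsLocallyFlatCharted.determinationLocus_eq_univ_or_finite_of_comap_covering f hf hsurj h hpk u₀ hcov A hopen hcore hcont

/-- **The same with the ends of `S′` read off a compactification `j′ : S′ ↪ X′`** (`X′` compact, punctures `pt i` with centred charts `φ′ i`, ends
`σ′ i z = φ′ᵢ⁻¹(e^{2πiz})`): open ends, compact core and continuous ends are then automatic (the tree's `Topology/PuncturedChartEnds`).
[cite: CattaniDeligneKaplan1995, Cor. 1.4 (p. 486), «Proof of 1.5 ⟹ 1.1» (p. 485), 2.3 (p. 487)] -/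
theorem translateLocus_line_eq_univ_or_finite_of_comap_covering_of_compactification (hf : IsCoveringMap f) (hsurj : Function.Surjective f)
    (h : (D.comap f).IsLocallyFlatCharted ψ' σ') {p : ℤ} (hpk : p + p = k) {s'₀ : S'} {u₀ : D.VZ.fiber (f s'₀)} (hu₀ : u₀ ≠ 0)
    (hcov : ∀ x' : S', ∃ a, x' ∈ (ψ' a).source) (A : ι₁ → ℝ)
    {j' : S' → X'} (hj' : IsEmbedding j') (pt : ι₁ → X') (hpS : ∀ i, pt i ∉ range j') (hcovX : ∀ x : X', x ∉ range j' → ∃ i, x = pt i)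
    (φ' : ι₁ → OpenPartialHomeomorph X' ℂ) (hp : ∀ i, pt i ∈ (φ' i).source) (hφp : ∀ i, φ' i (pt i) = 0)
    (hball : ∀ i, Metric.ball (0 : ℂ) (Real.exp (-(2 * Real.pi * A i))) ⊆ (φ' i).target)
    (hσ : ∀ (i : ι₁) (z : ℂ), A i < z.im → j' (σ' i z) = (φ' i).symm (Complex.exp (2 * Real.pi * Complex.I * z))) :
    {t : S | ∃ γ : Path.Homotopic.Quotient (f s'₀) t, ∃ W : SubHodgeStructure (D.hodge t),
        W.toSubmodule = (ℚ ∙ D.toRat (f s'₀) u₀).map (D.V.transport γ)} = univ ∨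
      {t : S | ∃ γ : Path.Homotopic.Quotient (f s'₀) t, ∃ W : SubHodgeStructure (D.hodge t),
        W.toSubmodule = (ℚ ∙ D.toRat (f s'₀) u₀).map (D.V.transport γ)}.Finite :=
  translateLocus_line_eq_univ_or_finite_of_comap_covering f hf hsurj h hpk hu₀ hcov A (Topology.isOpen_image_ends hj' φ' A hball σ' hσ)
    (Topology.exists_isCompact_core hj' pt hpS hcovX φ' hp hφp A hball σ' hσ) (continuousOn_end_lifts hj' φ' A hball σ' hσ)

/-- **COR. 1.4 FOR FINITELY MANY RATIONAL LINES `ℚ·u_m ⊆ V_{f(s′₀)}` AT ONCE ON `S`, FROM FLAT CHARTS OF `f^*D` ON A COVERING**: the set of `t ∈ S` for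
which ONE path class `γ : f(s′₀) ⇝ t` carries EVERY line `ℚ·u_m` (`u m ≠ 0` integral, `m ∈ ι'` finite) to a sub-Hodge structure of `V_t` is ALL of `S`
or FINITE. [cite: CattaniDeligneKaplan1995, Cor. 1.4 (p. 486), Cor. 1.3 (p. 484), «Proof of 1.5 ⟹ 1.1» (p. 485)]
[cite: MoonenOort2013Torelli, §3 Def. 4 and Rem. 5 (arXiv p. 9)] -/
theorem setOf_exists_forall_subHodgeStructure_translate_line_eq_univ_or_finite_of_comap_covering {ι' : Type*} [Finite ι']
    (hf : IsCoveringMap f) (hsurj : Function.Surjective f) (h : (D.comap f).IsLocallyFlatCharted ψ' σ') {p : ℤ} (hpk : p + p = k) {s'₀ : S'}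
    {u : ι' → D.VZ.fiber (f s'₀)} (hu : ∀ m, u m ≠ 0) (hcov : ∀ x' : S', ∃ a, x' ∈ (ψ' a).source) (A : ι₁ → ℝ)
    (hopen : ∀ (i : ι₁) (A' : ℝ), A i ≤ A' → IsOpen (σ' i '' {z : ℂ | A' < z.im}))
    (hcore : ∀ A' : ι₁ → ℝ, (∀ i, A i ≤ A' i) → ∃ K₀ : Set S', IsCompact K₀ ∧ K₀ ∪ ⋃ i, σ' i '' {z : ℂ | A' i < z.im} = univ)
    (hcont : ∀ i, ContinuousOn (σ' i) {z : ℂ | A i < z.im}) :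
    {t : S | ∃ γ : Path.Homotopic.Quotient (f s'₀) t, ∀ m, ∃ W : SubHodgeStructure (D.hodge t),
        W.toSubmodule = (ℚ ∙ D.toRat (f s'₀) (u m)).map (D.V.transport γ)} = univ ∨
      {t : S | ∃ γ : Path.Homotopic.Quotient (f s'₀) t, ∀ m, ∃ W : SubHodgeStructure (D.hodge t),
        W.toSubmodule = (ℚ ∙ D.toRat (f s'₀) (u m)).map (D.V.transport γ)}.Finite := by
  haveI : ∀ s : S, Module.Finite ℚ (D.V.fiber s) := fun s => D.finite_fiber s
  have heq : {t : S | ∃ γ : Path.Homotopic.Quotient (f s'₀) t, ∀ m, ∃ W : SubHodgeStructure (D.hodge t),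
      W.toSubmodule = (ℚ ∙ D.toRat (f s'₀) (u m)).map (D.V.transport γ)} =
      {t : S | ∃ γ : Path.Homotopic.Quotient (f s'₀) t, ∀ m, D.IsHodgeAt t p (D.VZ.transport γ (u m))} :=
    Set.ext fun _ => exists_congr fun γ => forall_congr' fun m => D.exists_subHodgeStructure_translate_line_iff_isHodgeAt γ (hu m) hpk
  rw [heq]
  exact simultaneousDeterminationLocus_eq_univ_or_finite_of_comap_covering (fun _ : ι' => D) hf hsurj (fun _ => h) (fun _ => hpk) u hcov A hopen
    hcore hcont

end IsLocallyFlatCharted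

/-- **COR. 1.4 FOR A RATIONAL SUBSPACE `U ⊆ V_{f(s′₀)}` OF DIMENSION `d` ON `S`, FROM FLAT CHARTS OF `⋀ᵈ(f^*D) = f^*(⋀ᵈ D)` ON A COVERING `S′ → S`**
(«reduces us to the one-dimensional case» — the locus of `U` is the determination locus of an integral frame `m₁ ∧ ⋯ ∧ m_d` in `⋀ᵈ D`, which descends
along `f` —; `P + P = d·k`): **everything or finite.** [cite: CattaniDeligneKaplan1995, Cor. 1.4 and its proof (p. 486), Cor. 1.3 (p. 484),
«Proof of 1.5 ⟹ 1.1» (p. 485)] [cite: Deligne1970, I.1] -/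
theorem translateLocus_eq_univ_or_finite_of_isLocallyFlatCharted_exteriorPower_comap_covering (hf : IsCoveringMap f)
    (hsurj : Function.Surjective f) {d : ℕ} (h : ((D.comap f).exteriorPower d).IsLocallyFlatCharted ψ' σ') {P : ℤ} (hP : P + P = d * k)
    {s'₀ : S'} (U : Submodule ℚ (D.V.fiber (f s'₀))) (hd : Module.finrank ℚ U = d) (hcov : ∀ x' : S', ∃ a, x' ∈ (ψ' a).source) (A : ι₁ → ℝ)
    (hopen : ∀ (i : ι₁) (A' : ℝ), A i ≤ A' → IsOpen (σ' i '' {z : ℂ | A' < z.im}))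
    (hcore : ∀ A' : ι₁ → ℝ, (∀ i, A i ≤ A' i) → ∃ K₀ : Set S', IsCompact K₀ ∧ K₀ ∪ ⋃ i, σ' i '' {z : ℂ | A' i < z.im} = univ)
    (hcont : ∀ i, ContinuousOn (σ' i) {z : ℂ | A i < z.im}) :
    {t : S | ∃ γ : Path.Homotopic.Quotient (f s'₀) t, ∃ W : SubHodgeStructure (D.hodge t), W.toSubmodule = U.map (D.V.transport γ)} = univ ∨
      {t : S | ∃ γ : Path.Homotopic.Quotient (f s'₀) t, ∃ W : SubHodgeStructure (D.hodge t),
        W.toSubmodule = U.map (D.V.transport γ)}.Finite := by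
  obtain ⟨m, -, heq⟩ := D.exists_translateLocus_eq_determinationLocus_exteriorPower (f s'₀) U hd hP
  rw [heq]
  exact VHSData.IsLocallyFlatCharted.determinationLocus_eq_univ_or_finite_of_comap_covering (D := D.exteriorPower d) f hf hsurj h hP _ hcov A
    hopen hcore hcont

/-- **The same with the ends of `S′` read off a compactification of `S′`.** [cite: CattaniDeligneKaplan1995, Cor. 1.4 (p. 486), 2.3 (p. 487)] -/
theorem translateLocus_eq_univ_or_finite_of_isLocallyFlatCharted_exteriorPower_comap_covering_of_compactification (hf : IsCoveringMap f)
    (hsurj : Function.Surjective f) {d : ℕ} (h : ((D.comap f).exteriorPower d).IsLocallyFlatCharted ψ' σ') {P : ℤ} (hP : P + P = d * k)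
    {s'₀ : S'} (U : Submodule ℚ (D.V.fiber (f s'₀))) (hd : Module.finrank ℚ U = d) (hcov : ∀ x' : S', ∃ a, x' ∈ (ψ' a).source) (A : ι₁ → ℝ)
    {j' : S' → X'} (hj' : IsEmbedding j') (pt : ι₁ → X') (hpS : ∀ i, pt i ∉ range j') (hcovX : ∀ x : X', x ∉ range j' → ∃ i, x = pt i)
    (φ' : ι₁ → OpenPartialHomeomorph X' ℂ) (hp : ∀ i, pt i ∈ (φ' i).source) (hφp : ∀ i, φ' i (pt i) = 0)
    (hball : ∀ i, Metric.ball (0 : ℂ) (Real.exp (-(2 * Real.pi * A i))) ⊆ (φ' i).target)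
    (hσ : ∀ (i : ι₁) (z : ℂ), A i < z.im → j' (σ' i z) = (φ' i).symm (Complex.exp (2 * Real.pi * Complex.I * z))) :
    {t : S | ∃ γ : Path.Homotopic.Quotient (f s'₀) t, ∃ W : SubHodgeStructure (D.hodge t), W.toSubmodule = U.map (D.V.transport γ)} = univ ∨
      {t : S | ∃ γ : Path.Homotopic.Quotient (f s'₀) t, ∃ W : SubHodgeStructure (D.hodge t),
        W.toSubmodule = U.map (D.V.transport γ)}.Finite :=
  translateLocus_eq_univ_or_finite_of_isLocallyFlatCharted_exteriorPower_comap_covering f hf hsurj h hP U hd hcov A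
    (Topology.isOpen_image_ends hj' φ' A hball σ' hσ) (Topology.exists_isCompact_core hj' pt hpS hcovX φ' hp hφp A hball σ' hσ)
    (continuousOn_end_lifts hj' φ' A hball σ' hσ)

/-- **COR. 1.4 FOR FINITELY MANY RATIONAL SUBSPACES `U_m ⊆ V_{f(s′₀)}` OF DIMENSIONS `d_m` AT ONCE ON `S`, FROM FLAT CHARTS OF THE `⋀^{d_m}(f^*D)` ON A
COVERING** (`P m + P m = d_m·k`): the set of `t ∈ S` for which ONE path class carries EVERY `U_m` to a sub-Hodge structure of `V_t` is ALL of `S` or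
FINITE — the simultaneous determination locus of integral frames in the family `(⋀^{d_m} D)_m`, descended along `f`.
[cite: CattaniDeligneKaplan1995, Cor. 1.4 (p. 486), Cor. 1.3 (p. 484), «Proof of 1.5 ⟹ 1.1» (p. 485)] [cite: MoonenOort2013Torelli, §3 Def. 4 (arXiv p. 9)] -/
theorem setOf_exists_forall_subHodgeStructure_translate_eq_univ_or_finite_of_exteriorPower_comap_covering {ι' : Type*} [Finite ι']
    (hf : IsCoveringMap f) (hsurj : Function.Surjective f) {d : ι' → ℕ} (h : ∀ m, ((D.comap f).exteriorPower (d m)).IsLocallyFlatCharted ψ' σ')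
    {P : ι' → ℤ} (hP : ∀ m, P m + P m = d m * k) {s'₀ : S'} (U : ι' → Submodule ℚ (D.V.fiber (f s'₀)))
    (hd : ∀ m, Module.finrank ℚ (U m) = d m) (hcov : ∀ x' : S', ∃ a, x' ∈ (ψ' a).source) (A : ι₁ → ℝ)
    (hopen : ∀ (i : ι₁) (A' : ℝ), A i ≤ A' → IsOpen (σ' i '' {z : ℂ | A' < z.im}))
    (hcore : ∀ A' : ι₁ → ℝ, (∀ i, A i ≤ A' i) → ∃ K₀ : Set S', IsCompact K₀ ∧ K₀ ∪ ⋃ i, σ' i '' {z : ℂ | A' i < z.im} = univ)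
    (hcont : ∀ i, ContinuousOn (σ' i) {z : ℂ | A i < z.im}) :
    {t : S | ∃ γ : Path.Homotopic.Quotient (f s'₀) t, ∀ m, ∃ W : SubHodgeStructure (D.hodge t),
        W.toSubmodule = (U m).map (D.V.transport γ)} = univ ∨
      {t : S | ∃ γ : Path.Homotopic.Quotient (f s'₀) t, ∀ m, ∃ W : SubHodgeStructure (D.hodge t),
        W.toSubmodule = (U m).map (D.V.transport γ)}.Finite := by
  have hfr := fun m => D.exists_integral_frame (f s'₀) (hd m)
  choose fr hli hU using hfr
  have heq : {t : S | ∃ γ : Path.Homotopic.Quotient (f s'₀) t, ∀ m, ∃ W : SubHodgeStructure (D.hodge t),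
      W.toSubmodule = (U m).map (D.V.transport γ)} =
      {t : S | ∃ γ : Path.Homotopic.Quotient (f s'₀) t, ∀ m, (D.exteriorPower (d m)).IsHodgeAt t (P m)
        ((D.exteriorPower (d m)).VZ.transport γ (_root_.exteriorPower.ιMulti ℤ (d m) (fr m)))} :=
    Set.ext fun _ => exists_congr fun γ => forall_congr' fun m =>
      D.exists_subHodgeStructure_translate_iff_isHodgeAt_exteriorPower_of_finrank_eq γ (hli m) (hU m) (hd m) (hP m)
  rw [heq]
  exact simultaneousDeterminationLocus_eq_univ_or_finite_of_comap_covering (fun m => D.exteriorPower (d m)) hf hsurj h hP _ hcov A hopen hcore hcont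

/-! ### From flat interior charts DOWNSTAIRS and flat puncture charts UPSTAIRS only -/

omit [PreconnectedSpace S'] in
/-- **COR. 1.4 FOR A RATIONAL LINE ON `S` FROM FLAT INTERIOR CHARTS OF `D` ON `S` AND FLAT PUNCTURE CHARTS OF `f^*D` ON A COVERING `S′ → S`**: `f` a
surjective covering map with sheets `e_b` covering `S′` (`S′` preconnected), discs `ψ_a` covering `S` carrying flat interior charts of `D` on small
balls, flat puncture charts of `f^*D` along the ends `σ′ i` of `S′` (open ends, compact core, continuous ends) — the interior half upstairs is automatic
(`IsLocallyFlatCharted.comap_of_sheets`); then for `u₀ ≠ 0` integral and `p + p = k` the Cor-1.4 locus of the line `ℚ·u₀ ⊆ V_{f(s′₀)}` is ALL of `S` or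
FINITE. [cite: CattaniDeligneKaplan1995, Cor. 1.4 (p. 486), Cor. 1.3 (p. 484), «Proof of 1.5 ⟹ 1.1» (p. 485), (2.4) (p. 488)]
[cite: FritzscheGrauert2002, Ch. IV §1] -/
theorem translateLocus_line_eq_univ_or_finite_of_sheets [PreconnectedSpace S'] {α β : Type*} (ψ : α → OpenPartialHomeomorph S ℂ)
    (E : β → OpenPartialHomeomorph S' S) (hE : ∀ b x, E b x = f x) (hf : IsCoveringMap f) (hsurj : Function.Surjective f)
    (hcov : ∀ y : S, ∃ a, y ∈ (ψ a).source) (hcov' : ∀ x : S', ∃ b, x ∈ (E b).source)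
    (hint : ∀ a, ∀ y ∈ (ψ a).source, ∃ r > 0, Metric.ball (ψ a y) r ⊆ (ψ a).target ∧
      ∃ (V : Type) (_ : AddCommGroup V) (_ : Module ℚ V) (_ : FiniteDimensional ℚ V) (H₀ : HodgeStructure V k) (P₀ : H₀.Polarization)
        (C : D.InteriorChart (restrBall (ψ a) y r) P₀), C.IsFlat)
    (hpunct : ∀ i, ∃ (V : Type) (_ : AddCommGroup V) (_ : Module ℚ V) (_ : FiniteDimensional ℚ V) (L : PolarizedLimitMixedHodgeStructure V k)
      (C : (D.comap f).PunctureChart (σ' i) L), C.IsFlat)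
    {p : ℤ} (hpk : p + p = k) {s'₀ : S'} {u₀ : D.VZ.fiber (f s'₀)} (hu₀ : u₀ ≠ 0) (A : ι₁ → ℝ)
    (hopen : ∀ (i : ι₁) (A' : ℝ), A i ≤ A' → IsOpen (σ' i '' {z : ℂ | A' < z.im}))
    (hcore : ∀ A' : ι₁ → ℝ, (∀ i, A i ≤ A' i) → ∃ K₀ : Set S', IsCompact K₀ ∧ K₀ ∪ ⋃ i, σ' i '' {z : ℂ | A' i < z.im} = univ)
    (hcont : ∀ i, ContinuousOn (σ' i) {z : ℂ | A i < z.im}) :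
    {t : S | ∃ γ : Path.Homotopic.Quotient (f s'₀) t, ∃ W : SubHodgeStructure (D.hodge t),
        W.toSubmodule = (ℚ ∙ D.toRat (f s'₀) u₀).map (D.V.transport γ)} = univ ∨
      {t : S | ∃ γ : Path.Homotopic.Quotient (f s'₀) t, ∃ W : SubHodgeStructure (D.hodge t),
        W.toSubmodule = (ℚ ∙ D.toRat (f s'₀) u₀).map (D.V.transport γ)}.Finite := by
  haveI : ∀ s : S, Module.Finite ℚ (D.V.fiber s) := fun s => D.finite_fiber s
  rw [D.translateLocus_line_eq_determinationLocus (f s'₀) hu₀ hpk]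
  exact D.determinationLocus_eq_univ_or_finite_of_sheets f ψ E hE hf hsurj hcov hcov' hint hpunct hpk u₀ A hopen hcore hcont

end Motives.VHSData

end Literature.AlgebraicGeometry

end
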